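import Literature.MathematicalPhysics.QuantumLattice.SpinChains
import Literature.MathematicalPhysics.QuantumLattice.HeisenbergModelProofs
import HarnessLib

/-!
# Discharge for `SpinChains`: the AKLT ring is the AKLT Hamiltonian on the `d = 1` torus graph

Sibling proof file of `Literature/MathematicalPhysics/QuantumLattice/SpinChains.lean`: it discharges
the named fact `akltRing_eq_reindexOp_akltHamiltonian_torusGraph` (`def … : Prop`, D-0014) of that
file as `theorem akltRing_eq_reindexOp_akltHamiltonian_torusGraph_holds`, from Mathlib and the API
of `SpinSystem` / `HeisenbergModel` / `HeisenbergModelProofs` / `LatticeGraph`. No statement of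
`SpinChains` is changed and no definition or named fact is introduced.

The identity proved is the bookkeeping statement that, for `3 ≤ L`, the periodic AKLT ring
`akltRing L = Σ_{i ∈ ℤ/Lℤ} (𝐒_i · 𝐒_{i+1} + ⅓ (𝐒_i · 𝐒_{i+1})²)` (AKLT (1988) eq. (1.2); Tasaki (2020)
§7.1, eq. (7.1.1)) equals the graph AKLT Hamiltonian
`akltHamiltonian G = biquadraticHamiltonian 2 G 1 (1/3) = Σ_{{x,y} ∈ E(G)} (𝐒_x · 𝐒_y + ⅓ (𝐒_x · 𝐒_y)²)`
on the one-dimensional torus graph `G = torusGraph 1 L` (vertex type `Fin 1 → ZMod L`), transported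
along `Fin 1 → ZMod L ≃ ZMod L`. The proof is the same reordering as for the Heisenberg ring
(`heisenbergRing_eq_heisenbergHamiltonian_torusGraph_holds` of `HeisenbergModelProofs`), whose
lemmas are reused:

* for `3 ≤ L` the edges of `torusGraph 1 L` are exactly the `L` distinct ring bonds `{i, i+1}`,
  `i : ZMod L` (as constant functions): `ringBond_mem_edgeFinset_torusGraph`, `ringBond_injective`
  (this is where `L = 2` fails: the ring counts the single edge `{0, 1}` twice),
  `exists_ringBond_of_mem_edgeFinset_torusGraph`; the edge sum is reordered along `i ↦ {i, i+1}`
  with `Finset.sum_nbij`;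
* relabelling sites along `e : Λ ≃ Λ'` is an algebra isomorphism moving `𝐒_x · 𝐒_y` to
  `𝐒_{e x} · 𝐒_{e y}` (`reindexOp_spinDot`), hence it moves the AKLT bond term
  `h_{xy} = 𝐒_x · 𝐒_y + ⅓ (𝐒_x · 𝐒_y)²` to `h_{e x, e y}` (`reindexOp_akltBond`).

## Sources

* I. Affleck, T. Kennedy, E. H. Lieb, H. Tasaki, *Valence bond ground states in isotropic quantum
  antiferromagnets*, Comm. Math. Phys. 115 (1988) 477, §1, eq. (1.2): the periodic spin-1 chain
  `H = Σ_i [𝐒_i · 𝐒_{i+1} + ⅓ (𝐒_i · 𝐒_{i+1})²]` (`= Σ_i [2 P₂(i,i+1) - 2/3]`). [AKLT1988]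
* H. Tasaki, *Physics and Mathematics of Quantum Many-Body Systems* (Springer, 2020), §7.1,
  eq. (7.1.1): the AKLT Hamiltonian on the periodic chain of `L` sites. [Tasaki2020]
* S. Friedli, Y. Velenik, *Statistical Mechanics of Lattice Systems* (CUP, 2017), §3.1: the torus
  `(ℤ/Lℤ)^d` with nearest-neighbour edges (periodic boundary condition). [FriedliVelenik2017]

## Mathlib / Literature status

Uses `Finset.sum_nbij`, `Sym2.lift_mk`, `map_sum/map_add/map_smul/map_mul` (for the `ℂ`-algebra
isomorphism `reindexOp e`) from Mathlib; `akltBond`, `akltRing`,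
`akltRing_eq_reindexOp_akltHamiltonian_torusGraph` (`SpinChains`), `akltHamiltonian`,
`biquadraticHamiltonian`, `spinDot` (`HeisenbergModel`), `reindexOp_spinDot`,
`ringBond_mem_edgeFinset_torusGraph`, `ringBond_injective`,
`exists_ringBond_of_mem_edgeFinset_torusGraph` (`HeisenbergModelProofs`), `torusGraph`, `TorusSite`
(`LatticeGraph`). Nothing is deliberately omitted: the `L = 2` case is excluded by the statement
itself (one edge versus a doubly counted bond).
-/

noncomputable section

open Matrix Complex

namespace Literature.MathematicalPhysics.QuantumLattice

section ReindexAKLT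

variable {Λ Λ' : Type*} [Fintype Λ] [DecidableEq Λ] [Fintype Λ'] [DecidableEq Λ']

/-- Relabelling sites moves the AKLT bond term: `reindexOp e (h_{xy}) = h_{e x, e y}` for
`h_{xy} = 𝐒_x · 𝐒_y + ⅓ (𝐒_x · 𝐒_y)²`, since `reindexOp e` is an algebra isomorphism moving
`𝐒_x · 𝐒_y` (`reindexOp_spinDot`). AKLT (1988) §1, eq. (1.2); Bratteli–Robinson II §6.2.1
(covariance of the local structure). [folklore] -/
theorem reindexOp_akltBond (e : Λ ≃ Λ') (x y : Λ) :
    reindexOp e (akltBond x y) = akltBond (e x) (e y) := by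
  simp only [akltBond, map_add, map_smul, map_mul, reindexOp_spinDot]

end ReindexAKLT

section RingTorus

open Literature.Probability.LatticeModels

/-- The edge term of the graph AKLT Hamiltonian on the edge `{x, y}` is the AKLT bond term
`h_{xy} = 𝐒_x · 𝐒_y + ⅓ (𝐒_x · 𝐒_y)²` (the casts `((1 : ℝ) : ℂ) = 1`, `((1/3 : ℝ) : ℂ) = 1/3`).
AKLT (1988) §1, eq. (1.2); Tasaki (2020) §7.1, eq. (7.1.1). [cite: Tasaki2020, §7.1, eq. (7.1.1)] -/
theorem akltHamiltonian_eq_sum_akltBond {Λ : Type*} [Fintype Λ] [DecidableEq Λ]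
    (G : SimpleGraph Λ) [DecidableRel G.Adj] :
    akltHamiltonian G =
      ∑ e ∈ G.edgeFinset, Sym2.lift ⟨fun x y => akltBond x y, fun x y => by
        simp only [akltBond, spinDot_comm]⟩ e := by
  unfold akltHamiltonian biquadraticHamiltonian
  refine Finset.sum_congr rfl fun e _ => ?_
  induction e using Sym2.ind with
  | h x y =>
    rw [Sym2.lift_mk, Sym2.lift_mk]
    show ((1 : ℝ) : ℂ) • spinDot 2 x y + ((1 / 3 : ℝ) : ℂ) • (spinDot 2 x y * spinDot 2 x y) =
      akltBond x y
    rw [Complex.ofReal_one, one_smul, Complex.ofReal_div, Complex.ofReal_one, Complex.ofReal_ofNat]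
    rfl

/-- **Discharge of `akltRing_eq_reindexOp_akltHamiltonian_torusGraph`.** For `3 ≤ L` the AKLT
ring `Σ_{i ∈ ℤ/Lℤ} (𝐒_i · 𝐒_{i+1} + ⅓ (𝐒_i · 𝐒_{i+1})²)` (AKLT (1988) eq. (1.2); Tasaki (2020) §7.1,
eq. (7.1.1), periodic chain) is the graph AKLT Hamiltonian `Σ_{{x,y} ∈ E} h_{xy}` on the
one-dimensional torus graph `torusGraph 1 L` (Friedli–Velenik (2017) §3.1), transported along
`Fin 1 → ZMod L ≃ ZMod L`: reorder the edge sum along the bijection `i ↦ {i, i+1}`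
(`Finset.sum_nbij`, using `ringBond_mem_edgeFinset_torusGraph`, `ringBond_injective`,
`exists_ringBond_of_mem_edgeFinset_torusGraph`) and move each term with `reindexOp_akltBond`.
[cite: Tasaki2020, §7.1, eq. (7.1.1)] -/
theorem akltRing_eq_reindexOp_akltHamiltonian_torusGraph_holds :
    akltRing_eq_reindexOp_akltHamiltonian_torusGraph := by
  intro L _ hL
  unfold akltRing
  rw [akltHamiltonian_eq_sum_akltBond, map_sum]
  refine Finset.sum_nbij (fun i : ZMod L => s((fun _ => i : TorusSite 1 L), fun _ => i + 1))
    (fun i _ => ringBond_mem_edgeFinset_torusGraph hL i) ?_ ?_ ?_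
  · exact fun i _ j _ hij => ringBond_injective hL hij
  · intro b hb
    obtain ⟨i, rfl⟩ := exists_ringBond_of_mem_edgeFinset_torusGraph (Finset.mem_coe.1 hb)
    exact ⟨i, Finset.mem_coe.2 (Finset.mem_univ i), rfl⟩
  · intro i _
    rw [Sym2.lift_mk, reindexOp_akltBond]
    rfl

end RingTorus

end Literature.MathematicalPhysics.QuantumLattice
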